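import Summits.QuantumFields.BalabanUV.Beta.FP.PerfectMaxwellDict
import Literature.MathematicalPhysics.QuantumFieldTheory.Balaban1983to89.B5Momentum166Zd

/-!
# `BalabanUV.Beta.FP.PerfectMaxwellDictPlancherel` — road «FP» for binder row D1, leaf H2-P, sub-row H2-P-DICT (second half): THE MOMENTUM
# REPRESENTATION OF THE PERFECT EFFECTIVE LAPLACIAN `Δ_∞` ON REAL FINITELY SUPPORTED BOND FIELDS —
# `⟨B, Δ_∞B⟩ = (2π)^{−(d+1)} ∫_{[−π,π]^{d+1}} maxwellQ (Re W_∞(·,·;s)) (∂¹(s)) (B̃(s)) ds`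

HONEST DEPENDENCY (page 1, mandatory): continuum YM on T⁴ ⇐ BetaPertH ∧ nine spine estimates (0/9 proved); BetaPertH ⇐ (D1) ∧ (D4) ∧ CAP+tail;
G-an2-4 gates asym, D1 and NE2/3/4.  HONEST FRAMING (cell contract, verbatim): «discharging `BetaPertH` makes Bałaban's UV stability UNCONDITIONAL —
a real constructive-QFT result; it is NOT the continuum limit and NOT the Clay problem.»  THIS MODULE DISCHARGES NOTHING of the wall: it is the
third expression of (1.66) of [Balaban1984PropagatorsI] p. 29 («⟨B, Δ_kB⟩ = ½ Σ_{μ,ν} (2π)^{−d}∫dp′ [ … ]⁻¹ |(∂₁B)~_{μν}(p′)|²», located, NOT used as a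
hypothesis; typed on the torus as `B5Bounds167Lattice.formDk`, and for the SCALAR whole-lattice line as `B5Momentum166Zd.actionForm_eq_integral`)
AT `k = ∞` ON THE INFINITE UNIT LATTICE, proved as a THEOREM ABOUT OUR OBJECT `Δ_∞ = EffectiveLaplacianLimit.deltaZLim` from
`PerfectMaxwellDict` (kernel dictionary + form dictionary) by exchanging finite sums with the zone integral.  0 def; no `def … : Prop`; nothing cited
as a hypothesis; 0 sorry; 0 wall binders; NOT D1, NOT BetaPertH, NOT continuum, NOT Clay.  «not in print for Δ_∞; our bookkeeping».

ABSOLUTE RULE (cell charter, verbatim): «No internally-minted statement may enter as a cited fact. Every hypothesis is either kernel-proved in this package or a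
verbatim quotation of a PUBLISHED theorem with page reference. The manuscript(s) under audit are NOT citable for their own disputed steps — they are the thing
under adjudication; programme-internal (2001/route/tribunal) claims are never citable.»

WHAT (every `d`, every finite window `S ⊂ ℤ^{d+1}`, every real bond field `B : ℤ^{d+1} → Fin (d+1) → ℝ` read on `S`; `B̃_β(s) = FT S (B · β) s =
Σ_{y∈S} B(y,β) e^{−i s·y}` is (1.29) at `η = 1`, `B5Momentum166Zd.FT`, componentwise):
* §1 [folklore] phases: `cexp_phase_sub`, `conj_FT`.
* §2 `sum_integrand_bondSymbol_eq_quadForm` — at every momentum `s`, `Σ_{x,y∈S} Σ_{α,β} B(x,α)B(y,β)·(bondSymbol GsymInf α β)(s)·e^{i s·(x−y)} =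
  Σ_{α,β} conj(B̃_α(s))·bondSymbol GsymInf α β (s)·B̃_β(s)` (finite-sum algebra).
* §3 **`form_deltaZLim_eq_integral_maxwellQ`** — `Σ_{x,y∈S} Σ_{α,β} B(x,α)·Δ_∞((x,α),(y,β))·B(y,β) =
  (2π)^{−(d+1)} · ∫_{[−π,π]^{d+1}} maxwellQ (fun μ ν => Re W_∞(μ,ν;s)) (d1Sym s) (B̃(s)) ds` (`PerfectMaxwellDict.deltaZLim_eq_re_latticeKernel` +
  `integral_finsetSum` + §2 + `PerfectMaxwellDict.quadForm_bondSymbol_GsymInf` + `integral_ofReal`).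
* §4 consequences: **`form_deltaZLim_nonneg`** (`Δ_∞` is POSITIVE SEMIDEFINITE on real finitely supported bond fields — `W166Inf_ofReal_re_pos`,
  `maxwellQ_nonneg`, `setIntegral_nonneg`); `integrableOn_maxwellQ_perfect` (the momentum integrand is integrable on the zone);
  **`form_deltaZLim_ge_maxwell`** (`⟨B, Δ_∞B⟩ ≥ (4/π²)^{d+3} · (2π)^{−(d+1)}∫ maxwellQ 1 (d1Sym s) (B̃(s)) ds` — the momentum form of the lower half of
  (1.67) for `Δ_∞` relative to the plain Maxwell form; the position-space reading of the right-hand side as `½Σ_{μ,ν}Σ_x |(∂₁B)_{μν}(x)|²` is a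
  separate Parseval step, NOT done here).
* §5 (v1.1) `maxwellQ_perfect_le_one` (whole zone), **`form_deltaZLim_le_maxwell`** — the UPPER half, constant `(π²/4)^{2(d+1)+4}`.
Provenance: G-an2-4 swarm leaf prover 02, gen 34 (prover-b2b-balaban-gan24-formalise-leaf-02-g34-0), cross-lane on road FP's row H2-P-DICT, 2026-08-20.
-/

noncomputable section

namespace Summit.QuantumFields.BalabanUV.Beta.FP.PerfectMaxwellDictPlancherel

open MeasureTheory Finset Complex
open scoped BigOperators ComplexConjugate
open Literature.MathematicalPhysics.QuantumFieldTheory.Balaban1983to89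
open B4Strip (ofRealVec)
open B4ContourShift (BZ integrand fourierBox latticeKernel)
open B5Prop11Fiber (d1Sym)
open B5Ineq167SymbolZd (phase phase_sub)
open B5Momentum166Zd (FT phaseC_eq)
open Summit.QuantumFields.BalabanUV.Beta.GAN24.EffectiveLaplacianLimit (deltaZLim measurableSet_BZ volume_BZ_ne_top)
open Summit.QuantumFields.BalabanUV.Beta.FP.PerfectSymbol166 (W166Inf)
open Summit.QuantumFields.BalabanUV.Beta.FP.PerfectSymbol166Pos (W166Inf_ofReal_re_pos)
open Summit.QuantumFields.BalabanUV.Beta.FP.PerfectSymbolKMultiplierClosed (GsymInf)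
open Summit.QuantumFields.BalabanUV.Beta.FP.PerfectMaxwellSymbol (maxwellQ maxwellQ_nonneg maxwellQ_W166Inf_lower)
open Summit.QuantumFields.BalabanUV.Beta.FP.PerfectMaxwellDict (bondSymbol deltaZLim_eq_re_latticeKernel quadForm_bondSymbol_GsymInf
  integrableOn_integrand_GsymInf integrableOn_integrand_bondSymbol)

variable {d : ℕ}

/-! ## §1 Phases and the conjugate transform -/

/-- [folklore] `e^{i s·(x−y)} = e^{i s·x} · e^{−i s·y}` (complex phase of `B4ContourShift` versus the real phase of `B5Ineq167SymbolZd`). -/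
theorem cexp_phase_sub (s : Fin (d + 1) → ℝ) (x y : Fin (d + 1) → ℤ) :
    cexp (I * B4ContourShift.phase s (x - y)) =
      cexp (I * B4ContourShift.phase s x) * cexp (((-phase s y : ℝ) : ℂ) * I) := by
  rw [phaseC_eq, phaseC_eq, phase_sub, ← Complex.exp_add]
  congr 1
  push_cast
  ring

/-- [folklore] THE CONJUGATE TRANSFORM of a real field on a window: `conj B̃(s) = Σ_{y∈S} B(y) e^{+i s·y}`. -/
theorem conj_FT (S : Finset (Fin (d + 1) → ℤ)) (Bf : (Fin (d + 1) → ℤ) → ℝ) (s : Fin (d + 1) → ℝ) :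
    conj (FT S Bf s) = ∑ y ∈ S, (Bf y : ℂ) * cexp (I * B4ContourShift.phase s y) := by
  unfold FT
  rw [map_sum]
  refine Finset.sum_congr rfl fun y _ => ?_
  rw [map_mul, conj_ofReal, ← Complex.exp_conj, map_mul, conj_ofReal, conj_I, phaseC_eq]
  congr 1
  push_cast
  ring

/-! ## §2 The quadruple sum at a fixed momentum -/

/-- [folklore] Exchanging the window sums `x, y ∈ S` with the direction sums `α, β`. -/
theorem sum_swap4 (S : Finset (Fin (d + 1) → ℤ)) (F : (Fin (d + 1) → ℤ) → (Fin (d + 1) → ℤ) → Fin (d + 1) → Fin (d + 1) → ℂ) :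
    ∑ x ∈ S, ∑ y ∈ S, ∑ α, ∑ β, F x y α β = ∑ α, ∑ β, ∑ x ∈ S, ∑ y ∈ S, F x y α β := by
  calc ∑ x ∈ S, ∑ y ∈ S, ∑ α, ∑ β, F x y α β = ∑ x ∈ S, ∑ α, ∑ y ∈ S, ∑ β, F x y α β :=
        Finset.sum_congr rfl fun _ _ => Finset.sum_comm
    _ = ∑ α, ∑ x ∈ S, ∑ y ∈ S, ∑ β, F x y α β := Finset.sum_comm
    _ = ∑ α, ∑ x ∈ S, ∑ β, ∑ y ∈ S, F x y α β :=
        Finset.sum_congr rfl fun _ _ => Finset.sum_congr rfl fun _ _ => Finset.sum_comm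
    _ = ∑ α, ∑ β, ∑ x ∈ S, ∑ y ∈ S, F x y α β := Finset.sum_congr rfl fun _ _ => Finset.sum_comm

/-- [our object] **THE QUADRUPLE SUM AT A FIXED MOMENTUM IS THE QUADRATIC FORM OF THE SYMBOL MATRIX ON THE TRANSFORM**:
`Σ_{x,y∈S} Σ_{α,β} B(x,α)B(y,β) · (bondSymbol GsymInf α β)(s) e^{i s·(x−y)} = Σ_{α,β} conj(B̃_α(s)) · bondSymbol GsymInf α β (s) · B̃_β(s)`. -/
theorem sum_integrand_bondSymbol_eq_quadForm (S : Finset (Fin (d + 1) → ℤ)) (B : (Fin (d + 1) → ℤ) → Fin (d + 1) → ℝ)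
    (s : Fin (d + 1) → ℝ) :
    ∑ x ∈ S, ∑ y ∈ S, ∑ α, ∑ β, ((B x α * B y β : ℝ) : ℂ) * integrand (bondSymbol GsymInf α β) (x - y) s =
      ∑ α, ∑ β, conj (FT S (fun y => B y α) s) * bondSymbol GsymInf α β (ofRealVec s) * FT S (fun y => B y β) s := by
  have hR : ∀ α β, conj (FT S (fun y => B y α) s) * bondSymbol GsymInf α β (ofRealVec s) * FT S (fun y => B y β) s =
      ∑ x ∈ S, ∑ y ∈ S, ((B x α : ℂ) * cexp (I * B4ContourShift.phase s x)) * bondSymbol GsymInf α β (ofRealVec s) *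
        ((B y β : ℂ) * cexp (((-phase s y : ℝ) : ℂ) * I)) := by
    intro α β
    rw [conj_FT]
    unfold FT
    rw [Finset.sum_mul, Finset.sum_mul]
    refine Finset.sum_congr rfl fun x _ => ?_
    rw [Finset.mul_sum]
  simp_rw [hR]
  refine (sum_swap4 S _).trans (Finset.sum_congr rfl fun α _ => Finset.sum_congr rfl fun β _ =>
    Finset.sum_congr rfl fun x _ => Finset.sum_congr rfl fun y _ => ?_)
  unfold integrand
  rw [cexp_phase_sub]
  push_cast
  ring

/-! ## §3 The momentum representation of `⟨B, Δ_∞B⟩` -/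

/-- [folklore] Exchanging the zone integral with the quadruple finite sum. -/
theorem integral_sum4 {S : Finset (Fin (d + 1) → ℤ)}
    {F : (Fin (d + 1) → ℤ) → (Fin (d + 1) → ℤ) → Fin (d + 1) → Fin (d + 1) → (Fin (d + 1) → ℝ) → ℂ}
    (hF : ∀ x y α β, IntegrableOn (F x y α β) (BZ (d + 1))) :
    ∫ s in BZ (d + 1), ∑ x ∈ S, ∑ y ∈ S, ∑ α, ∑ β, F x y α β s =
      ∑ x ∈ S, ∑ y ∈ S, ∑ α, ∑ β, ∫ s in BZ (d + 1), F x y α β s := by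
  have h3 : ∀ x y, Integrable (fun s => ∑ α, ∑ β, F x y α β s) (volume.restrict (BZ (d + 1))) :=
    fun x y => integrable_finsetSum _ fun α _ => integrable_finsetSum _ fun β _ => hF x y α β
  rw [integral_finsetSum _ fun x _ => integrable_finsetSum _ fun y _ => h3 x y]
  refine Finset.sum_congr rfl fun x _ => ?_
  rw [integral_finsetSum _ fun y _ => h3 x y]
  refine Finset.sum_congr rfl fun y _ => ?_
  rw [integral_finsetSum _ fun α _ => integrable_finsetSum _ fun β _ => hF x y α β]
  refine Finset.sum_congr rfl fun α _ => ?_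
  exact integral_finsetSum _ fun β _ => hF x y α β

/-- [folklore] Integrability of the weighted integrand `B(x,α)B(y,β)·(bondSymbol GsymInf α β)(s)e^{i s·(x−y)}` on the zone
(`PerfectMaxwellDict.integrableOn_integrand_bondSymbol` + `integrableOn_integrand_GsymInf`). -/
theorem integrableOn_weighted_integrand (B : (Fin (d + 1) → ℤ) → Fin (d + 1) → ℝ) (x y : Fin (d + 1) → ℤ) (α β : Fin (d + 1)) :
    IntegrableOn (fun s => ((B x α * B y β : ℝ) : ℂ) * integrand (bondSymbol GsymInf α β) (x - y) s) (BZ (d + 1)) :=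
  (integrableOn_integrand_bondSymbol (fun _ _ h a b => integrableOn_integrand_GsymInf h a b _) α β).const_mul _

/-- [our object] **(1.66), THIRD EXPRESSION, FOR THE PERFECT EFFECTIVE LAPLACIAN ON THE INFINITE UNIT LATTICE**: for every finite window `S ⊂ ℤ^{d+1}`
and every real bond field `B` read on `S`,
`Σ_{x,y∈S} Σ_{α,β} B(x,α) · Δ_∞((x,α),(y,β)) · B(y,β) = (2π)^{−(d+1)} · ∫_{[−π,π]^{d+1}} maxwellQ (fun μ ν => Re W_∞(μ,ν;s)) (d1Sym s) (B̃(s)) ds`,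
`B̃_β(s) = Σ_{y∈S} B(y,β)e^{−i s·y}` — `⟨B, Δ_∞B⟩ = ½Σ_{μ,ν}(2π)^{−(d+1)}∫ Re W_∞(μ,ν;s)·|∂¹_μ(s)B̃_ν(s) − ∂¹_ν(s)B̃_μ(s)|² ds`. -/
theorem form_deltaZLim_eq_integral_maxwellQ (S : Finset (Fin (d + 1) → ℤ)) (B : (Fin (d + 1) → ℤ) → Fin (d + 1) → ℝ) :
    ∑ x ∈ S, ∑ y ∈ S, ∑ α, ∑ β, B x α * deltaZLim (d := d) (x, α) (y, β) * B y β =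
      ((2 * Real.pi) ^ (d + 1))⁻¹ *
        ∫ s in BZ (d + 1), maxwellQ (fun μ ν => (W166Inf μ ν (ofRealVec s)).re) (d1Sym s) (fun β => FT S (fun y => B y β) s) := by
  -- Step 1: each term is the real part of a weighted lattice kernel, itself a scaled zone integral
  have h1 : ∀ x y α β, B x α * deltaZLim (d := d) (x, α) (y, β) * B y β =
      ((((((2 * Real.pi) ^ (d + 1))⁻¹ : ℝ) : ℂ)) *
        ∫ s in BZ (d + 1), ((B x α * B y β : ℝ) : ℂ) * integrand (bondSymbol GsymInf α β) (x - y) s).re := by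
    intro x y α β
    rw [deltaZLim_eq_re_latticeKernel]
    unfold latticeKernel fourierBox
    simp only [Complex.real_smul, re_ofReal_mul, integral_const_mul]
    ring
  simp_rw [h1]
  simp only [← re_sum, ← Finset.mul_sum]
  -- Step 2: exchange sums and integral, rewrite the integrand on the zone, pull out the real integral
  rw [← integral_sum4 (fun x y α β => integrableOn_weighted_integrand B x y α β)]
  rw [setIntegral_congr_fun (measurableSet_BZ d) (fun s hs => by
    rw [sum_integrand_bondSymbol_eq_quadForm, quadForm_bondSymbol_GsymInf hs])]
  rw [integral_complex_ofReal, ← ofReal_mul, ofReal_re]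

/-! ## §4 Consequences -/

/-- [our object] **`Δ_∞` IS POSITIVE SEMIDEFINITE ON REAL FINITELY SUPPORTED BOND FIELDS**: `0 ≤ Σ_{x,y∈S} Σ_{α,β} B(x,α)·Δ_∞((x,α),(y,β))·B(y,β)`
(the weights `Re W_∞` are positive on the zone, `PerfectSymbol166Pos.W166Inf_ofReal_re_pos`). -/
theorem form_deltaZLim_nonneg (S : Finset (Fin (d + 1) → ℤ)) (B : (Fin (d + 1) → ℤ) → Fin (d + 1) → ℝ) :
    0 ≤ ∑ x ∈ S, ∑ y ∈ S, ∑ α, ∑ β, B x α * deltaZLim (d := d) (x, α) (y, β) * B y β := by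
  rw [form_deltaZLim_eq_integral_maxwellQ]
  refine mul_nonneg (by positivity) (setIntegral_nonneg (measurableSet_BZ d) fun s hs => ?_)
  exact maxwellQ_nonneg (fun μ ν h => (W166Inf_ofReal_re_pos h hs).le) _ _

/-- [folklore] THE MOMENTUM INTEGRAND IS INTEGRABLE ON THE ZONE: `s ↦ maxwellQ (Re W_∞(·,·;s)) (d1Sym s) (B̃(s))` (it is, on the zone, the real part of a
finite combination of the integrable perfect entry integrands). -/
theorem integrableOn_maxwellQ_perfect (S : Finset (Fin (d + 1) → ℤ)) (B : (Fin (d + 1) → ℤ) → Fin (d + 1) → ℝ) :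
    IntegrableOn (fun s => maxwellQ (fun μ ν => (W166Inf μ ν (ofRealVec s)).re) (d1Sym s) (fun β => FT S (fun y => B y β) s))
      (BZ (d + 1)) := by
  have hc : IntegrableOn (fun s => ∑ x ∈ S, ∑ y ∈ S, ∑ α, ∑ β,
      ((B x α * B y β : ℝ) : ℂ) * integrand (bondSymbol GsymInf α β) (x - y) s) (BZ (d + 1)) :=
    integrable_finsetSum _ fun x _ => integrable_finsetSum _ fun y _ => integrable_finsetSum _ fun α _ =>
      integrable_finsetSum _ fun β _ => integrableOn_weighted_integrand B x y α β
  have hc' : IntegrableOn (fun s => ((maxwellQ (fun μ ν => (W166Inf μ ν (ofRealVec s)).re) (d1Sym s)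
      (fun β => FT S (fun y => B y β) s) : ℝ) : ℂ)) (BZ (d + 1)) :=
    hc.congr_fun (fun s hs => by
      simp only
      rw [sum_integrand_bondSymbol_eq_quadForm, quadForm_bondSymbol_GsymInf hs]) (measurableSet_BZ d)
  show Integrable _ (volume.restrict (BZ (d + 1)))
  exact (hc'.re).congr (Filter.Eventually.of_forall fun s => by simp)

/-- [folklore] The plain Maxwell momentum integrand `s ↦ maxwellQ 1 (d1Sym s) (B̃(s))` is continuous, hence integrable on the zone. -/
theorem integrableOn_maxwellQ_one (S : Finset (Fin (d + 1) → ℤ)) (B : (Fin (d + 1) → ℤ) → Fin (d + 1) → ℝ) :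
    IntegrableOn (fun s => maxwellQ (fun _ _ => (1 : ℝ)) (d1Sym s) (fun β => FT S (fun y => B y β) s)) (BZ (d + 1)) := by
  have hc : Continuous fun s : Fin (d + 1) → ℝ => maxwellQ (fun _ _ => (1 : ℝ)) (d1Sym s) (fun β => FT S (fun y => B y β) s) := by
    unfold maxwellQ FT d1Sym phase
    refine continuous_finsetSum _ fun μ _ => continuous_finsetSum _ fun ν _ => ?_
    split_ifs
    · exact continuous_const
    · fun_prop
  unfold BZ
  exact hc.continuousOn.integrableOn_compact isCompact_Icc

/-- [our object] **THE LOWER HALF OF (1.67) FOR `Δ_∞`, MOMENTUM FORM**: `⟨B, Δ_∞B⟩ ≥ (4/π²)^{(d+1)+2} · (2π)^{−(d+1)} ∫ maxwellQ 1 (d1Sym s) (B̃(s)) ds`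
— the perfect effective Laplacian dominates `(4/π²)^{d+3}` times the plain Maxwell form in momentum space (`maxwellQ_W166Inf_lower` under the integral).
The position-space reading of the right-hand side (`½Σ_{μ,ν}Σ_x|(∂₁B)_{μν}(x)|²`, Parseval) is NOT done here. -/
theorem form_deltaZLim_ge_maxwell (S : Finset (Fin (d + 1) → ℤ)) (B : (Fin (d + 1) → ℤ) → Fin (d + 1) → ℝ) :
    (4 / Real.pi ^ 2) ^ (d + 1 + 2) * (((2 * Real.pi) ^ (d + 1))⁻¹ *
        ∫ s in BZ (d + 1), maxwellQ (fun _ _ => (1 : ℝ)) (d1Sym s) (fun β => FT S (fun y => B y β) s)) ≤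
      ∑ x ∈ S, ∑ y ∈ S, ∑ α, ∑ β, B x α * deltaZLim (d := d) (x, α) (y, β) * B y β := by
  rw [form_deltaZLim_eq_integral_maxwellQ, mul_left_comm, ← integral_const_mul]
  refine mul_le_mul_of_nonneg_left ?_ (by positivity)
  refine setIntegral_mono_on ((integrableOn_maxwellQ_one S B).const_mul _) (integrableOn_maxwellQ_perfect S B)
    (measurableSet_BZ d) fun s hs => ?_
  exact maxwellQ_W166Inf_lower hs _ _

/-! ## §5 (v1.1) The upper half: `⟨B, Δ_∞B⟩ ≤ (π²/4)^{2(d+1)+4} · (2π)^{−(d+1)}∫ maxwellQ 1 (d1Sym s) (B̃(s)) ds` -/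

/-- [our object] THE WEIGHTED INTEGRAND IS DOMINATED BY PLAIN MAXWELL ON THE WHOLE ZONE: off the origin by `maxwellQ_W166Inf_upper`; AT the origin both sides
vanish (`d1Sym 0 = 0`, every plaquette term is `0`). -/
theorem maxwellQ_perfect_le_one {s : Fin (d + 1) → ℝ} (hs : s ∈ BZ (d + 1)) (v : Fin (d + 1) → ℂ) :
    maxwellQ (fun μ ν => (W166Inf μ ν (ofRealVec s)).re) (d1Sym s) v ≤
      (Real.pi ^ 2 / 4) ^ (2 * (d + 1) + 4) * maxwellQ (fun _ _ => (1 : ℝ)) (d1Sym s) v := by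
  by_cases h0 : s = 0
  · subst h0
    have hz : d1Sym (0 : Fin (d + 1) → ℝ) = 0 := funext fun μ => by simp [d1Sym]
    rw [hz]
    unfold maxwellQ
    simp
  · obtain ⟨ν₀, hν₀⟩ : ∃ ν₀, s ν₀ ≠ 0 := by
      by_contra hall
      push Not at hall
      exact h0 (funext hall)
    exact PerfectMaxwellSymbol.maxwellQ_W166Inf_upper hs ν₀ hν₀ _ v

/-- [our object] **THE UPPER HALF OF (1.67) FOR `Δ_∞`, MOMENTUM FORM**:
`Σ_{x,y∈S}Σ_{α,β} B(x,α)·Δ_∞((x,α),(y,β))·B(y,β) ≤ (π²/4)^{2(d+1)+4} · (2π)^{−(d+1)} ∫ maxwellQ 1 (d1Sym s) (B̃(s)) ds`. -/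
theorem form_deltaZLim_le_maxwell (S : Finset (Fin (d + 1) → ℤ)) (B : (Fin (d + 1) → ℤ) → Fin (d + 1) → ℝ) :
    ∑ x ∈ S, ∑ y ∈ S, ∑ α, ∑ β, B x α * deltaZLim (d := d) (x, α) (y, β) * B y β ≤
      (Real.pi ^ 2 / 4) ^ (2 * (d + 1) + 4) * (((2 * Real.pi) ^ (d + 1))⁻¹ *
        ∫ s in BZ (d + 1), maxwellQ (fun _ _ => (1 : ℝ)) (d1Sym s) (fun β => FT S (fun y => B y β) s)) := by
  rw [form_deltaZLim_eq_integral_maxwellQ, mul_left_comm, ← integral_const_mul ((Real.pi ^ 2 / 4) ^ (2 * (d + 1) + 4))]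
  refine mul_le_mul_of_nonneg_left ?_ (by positivity)
  refine setIntegral_mono_on (integrableOn_maxwellQ_perfect S B) ((integrableOn_maxwellQ_one S B).const_mul _)
    (measurableSet_BZ d) fun s hs => ?_
  exact maxwellQ_perfect_le_one hs _

end Summit.QuantumFields.BalabanUV.Beta.FP.PerfectMaxwellDictPlancherel

end
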